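import Literature.NumberTheory.EllipticCurves.TateCurve.UniformizationHolds
import Literature.NumberTheory.EllipticCurves.TateCurve.UniformizationDescent
import Mathlib.FieldTheory.Galois.Infinite
import Mathlib.FieldTheory.KummerPolynomial
import Mathlib.RingTheory.Polynomial.Cyclotomic.Roots
import HarnessLib

/-!
# Route `ErratumRoadFive` (K2, `p ≥ 5`), crux (T) `Rest3TorsionBranchAtFive` (item
# stmt-BirchSwinnertonDyer-19702): TORSION RIGIDITY OF THE TATE CURVE — a Tate curve acquires no new
# `p`-power torsion in a normal extension without `μ_p` (Lemma (L1) of THEOREM T♭, PROVED in the kernel)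

Cell `bsd-stepL` (run/shared/lean/pub/bsd-stepL/), seat `bsd-stepL-bdp` (prover g14, 2026-08-26), memo
`HOME/proof/PROOF-BDP.md` §31 (THEOREM T♭: Castella's erratum Thm. 1.1 WITHOUT hypothesis (iv)
`E(ℚ_p)[p] = 0`) and §32 (this file); `--supports stmt-BirchSwinnertonDyer-19702 --as helper`.

HONEST FRAMING: theorems only (no definition, no named fact, no `sorry`), FACT-FREE: the only arithmetic
input is Tate's uniformisation `φ : K̄^× ↠ E_q(K̄)`, kernel `q^ℤ`, `G_K`-equivariant (Silverman ATAEC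
V.3.1 (c)(d)) = the tree's THEOREM `Literature.NumberTheory.EllipticCurves.TateCurve.uniformization_holds`
(abc-iut cell). Nothing about Selmer groups, `L`-functions or preprints is asserted; nothing is booked;
no census word, tier or label moves (T7).

## What and why

THEOREM T♭ (memo §31) removes hypothesis (iv) from the erratum road on the 2 571 class-wide pairs of
branch (T) carrying an erratum witness: the exact control of the erratum's Lemma 2.1 becomes a control
with defect `↪ H⁰(K_𝔭, M)/ϖ^m = ⊕_{w ∣ 𝔭} E(K_{∞,w})[p^∞]/ϖ^m`, and the road survives provided the
defect is FINITE AND BOUNDED INDEPENDENTLY OF `m` (algebra: g13's `ErratumRoadFiveBoundedCongruenceLimit*`,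
`…FittingExtensionInequality`). The bound is Lemma (L1): for the Tate curve `E/ℚ_p` (`p` odd) and the
anticyclotomic LOCAL tower `K_{∞,w}/ℚ_p` — a `ℤ_p`-extension: normal, pro-`p`, without `μ_p` —
**`E(K_{∞,w})[p^∞] = E(ℚ_p)[p^∞] ≅ ℤ/p^k`**, `k = max{j : q_E ∈ (ℚ_p^×)^{p^j}}`. g13 recorded (L1) as
«not kernel-typed (no Tate uniformisation in the tree)»; the tree DOES have it (`TateCurve/`, abc-iut
cell), and THIS FILE proves (L1) on the tree's objects:
* §1 (group theory) `mem_zpowers_of_pow_prime_pow_eq_zpow`: in a commutative group, inside a subgroup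
  `S` without elements of order `p` in which `r` is no `p`-th power, `u^{p^n} = r^b ⇒ u ∈ r^ℤ`; so
  `(S/q^ℤ)[p^∞] = r^ℤ/q^ℤ` for `q = r^{p^k}`, the same for every `S` (`pow_prime_pow_mem_zpowers_iff`).
* §2 (Kummer theory in `K̄`, `char K = 0`) `pow_prime_ne_algebraMap_of_fixed`: for `H ⊴ G_K` NORMAL with
  `μ_p(K̄^H) = 1` and `r ∈ K ∖ K^p`, no `H`-fixed element is a `p`-th root of `r` (a mover `σ` of
  `r^{1/p}` would give an `H`-fixed `ζ_p`); `fixed_pow_prime_eq_one_of_degree`: `μ_p(K̄^H) = 1` from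
  `μ_p(K) = 1` and `p`-power degrees of `H`-fixed elements (pro-`p`).
* §3 (`tateCurve q` over a complete ultrametric `K` of characteristic `0`, `q = r^{p^k}`, `0 < ‖r‖ < 1`,
  `r ∉ K^p`, `H ⊴ G_K`, `μ_p(K̄^H) = 1`) `smul_eq_self_of_fixed_of_torsion`: **every `H`-fixed
  `p`-power-torsion point of `E_q(K̄)` is `G_K`-fixed**; `exists_generator_fixed_torsion`: they are the
  multiples of ONE `K`-rational point of exact order `p^k` (`#E_q(K̄^H)[p^∞] = p^k` for every such `H`).
  Mechanism (`exists_eq_map_zpow_of_fixed_of_torsion`): `P = φ(w)`, `w^{p^n} ∈ q^ℤ`; for `τ ∈ H`,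
  `τw/w ∈ q^ℤ` is a root of unity, hence `1`; §1 in the `H`-fixed units gives `w ∈ r^ℤ ⊂ K^×`.

The `ℚ_p`-specialisation is the companion file `ErratumRoadFiveTateTorsionRigidityPadic.lean`. NOT here:
the identification of the global module `E(K̄)[p^∞]` on a decomposition group with the local Tate
curve's, and T♭'s Selmer bookkeeping (residual Selmer groups are not constructed in the tree).

References: [SilvermanATAEC1994] Thm. V.3.1 (c),(d) (PDF pp. 395–399); [Castella2018Erratum] Lemma 2.1,
Remark (2) (p. 2); memo §31.2; tree `TateCurve/UniformizationHolds.lean`, `…/UniformizationDescent.lean`.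
-/

set_option autoImplicit false
-- the Theorems namespace of this sub repeats the summit name by design (D-0017 nested layout)
set_option linter.dupNamespace false

noncomputable section

open scoped Classical

namespace Summit.BirchSwinnertonDyer.BirchSwinnertonDyer.Theorems.TateTorsionRigidity

universe u v

/-! ### §1 Group theory: `p`-power torsion of `G/q^ℤ` does not grow without `μ_p` and `p`-th roots of `r` -/

section Group

variable {G : Type u} [CommGroup G] {p : ℕ}

/-- **The torsion computation behind (L1)** (memo §31.2 (γ), abstract form). `G` a commutative group,
`S ≤ G` a subgroup with NO element of order `p` (`p` prime), `r ∈ S` NOT a `p`-th power in `S`: if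
`u ∈ S` has `u ^ p ^ n = r ^ b` (`b : ℤ`) then `u ∈ r^ℤ`. Induction on `n`: if `p ∣ b = p b₁` then
`(u^{p^n} r^{-b₁})^p = 1`, so `u^{p^n} = r^{b₁}`; if `p ∤ b`, Bezout `c p + d b = 1` gives
`r = (r^c · (u^{p^n})^d)^p`, a `p`-th power in `S`. [folklore] -/
theorem mem_zpowers_of_pow_prime_pow_eq_zpow (hp : p.Prime) (S : Subgroup G)
    (hS : ∀ g ∈ S, g ^ p = 1 → g = 1) {r : G} (hrS : r ∈ S) (hr : ∀ s ∈ S, s ^ p ≠ r) :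
    ∀ (n : ℕ) (u : G), u ∈ S → ∀ b : ℤ, u ^ p ^ n = r ^ b → u ∈ Subgroup.zpowers r := by
  intro n
  induction n with
  | zero =>
    intro u _ b hu
    rw [pow_zero, pow_one] at hu
    exact hu ▸ ⟨b, rfl⟩
  | succ n ih =>
    intro u huS b hu
    by_cases hpb : (p : ℤ) ∣ b
    · obtain ⟨b₁, rfl⟩ := hpb
      have h1 : (u ^ p ^ n * (r ^ b₁)⁻¹) ^ p = 1 := by
        rw [mul_pow, inv_pow, ← pow_mul, ← pow_succ, hu, mul_comm (p : ℤ) b₁, zpow_mul, zpow_natCast,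
          mul_inv_cancel]
      have h2 : u ^ p ^ n * (r ^ b₁)⁻¹ = 1 :=
        hS _ (S.mul_mem (S.pow_mem huS _) (S.inv_mem (S.zpow_mem hrS _))) h1
      rw [mul_inv_eq_one] at h2
      exact ih u huS b₁ h2
    · exfalso
      have hpZ : Prime (p : ℤ) := Nat.prime_iff_prime_int.mp hp
      have hcop : IsCoprime (p : ℤ) b := (Irreducible.coprime_iff_not_dvd hpZ.irreducible).mpr hpb
      obtain ⟨c, d, hcd⟩ := hcop
      -- `s := r^c · (u^{p^n})^d` is a `p`-th root of `r` inside `S`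
      refine hr (r ^ c * (u ^ p ^ n) ^ d) (S.mul_mem (S.zpow_mem hrS _)
        (S.zpow_mem (S.pow_mem huS _) _)) ?_
      have e1 : ((u ^ p ^ n) ^ d) ^ p = r ^ (d * b) := by
        rw [← zpow_natCast, ← zpow_mul, mul_comm d (p : ℤ), zpow_mul, zpow_natCast, ← pow_mul,
          ← pow_succ, hu, ← zpow_mul, mul_comm b d]
      rw [mul_pow, e1, ← zpow_natCast, ← zpow_mul, ← zpow_add, show c * (p : ℤ) + d * b = 1 from hcd,
        zpow_one]

/-- Set form with `q = r ^ p ^ k`: inside `S`, the elements with some `p`-power in `q^ℤ` are exactly `r^ℤ`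
(«`(S/q^ℤ)[p^∞] = r^ℤ/q^ℤ`», the same for every admissible `S`). [folklore] -/
theorem pow_prime_pow_mem_zpowers_iff (hp : p.Prime) (S : Subgroup G)
    (hS : ∀ g ∈ S, g ^ p = 1 → g = 1) {r : G} (hrS : r ∈ S) (hr : ∀ s ∈ S, s ^ p ≠ r) (k : ℕ)
    {u : G} (huS : u ∈ S) :
    (∃ n : ℕ, u ^ p ^ n ∈ Subgroup.zpowers (r ^ p ^ k)) ↔ u ∈ Subgroup.zpowers r := by
  constructor
  · rintro ⟨n, a, ha⟩
    refine mem_zpowers_of_pow_prime_pow_eq_zpow hp S hS hrS hr n u huS ((p ^ k : ℕ) * a) ?_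
    rw [← ha, zpow_mul, zpow_natCast]
  · rintro ⟨j, rfl⟩
    refine ⟨k, j, ?_⟩
    show (r ^ p ^ k) ^ j = (r ^ j) ^ p ^ k
    rw [← zpow_natCast r (p ^ k), ← zpow_mul, ← zpow_natCast (r ^ j) (p ^ k), ← zpow_mul, mul_comm]

end Group

/-! ### §2 Kummer theory in `K̄`: no `H`-fixed `p`-th root of `r` when `K̄^H` has no `μ_p` -/

section Kummer

open Field Polynomial

variable {K : Type u} [Field K] [CharZero K] {p : ℕ}

omit [CharZero K] in
/-- If `H ⊴ G_K` is NORMAL, the `G_K`-translates of an `H`-fixed element of `K̄` are `H`-fixed (the fixed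
field `K̄^H` is `G_K`-stable). [folklore] -/
theorem smul_fixed_of_normal (H : Subgroup (absoluteGaloisGroup K)) [hH : H.Normal]
    {x : AlgebraicClosure K} (hx : ∀ τ ∈ H, τ • x = x) (σ : absoluteGaloisGroup K) :
    ∀ τ ∈ H, τ • (σ • x) = σ • x := by
  intro τ hτ
  have hmem : σ⁻¹ * τ * σ ∈ H := by simpa using hH.conj_mem τ hτ σ⁻¹
  have h : (σ⁻¹ * τ * σ) • x = x := hx _ hmem
  calc τ • σ • x = σ • ((σ⁻¹ * τ * σ) • x) := by rw [mul_smul, mul_smul, smul_inv_smul]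
    _ = σ • x := by rw [h]

/-- **Kummer step (memo §31.2 (β)).** `char K = 0`, `p` prime, `H ⊴ G_K` normal, `r ∈ K ∖ K^p`. If some
`p`-th root `s ∈ K̄` of `r` is `H`-fixed then some PRIMITIVE `p`-th root of unity is `H`-fixed: `s ∉ K`, so
some `σ ∈ G_K` moves `s` (`InfiniteGalois.mem_bot_iff_fixed`), `σ s` is `H`-fixed (normality), and
`ζ = σ s / s` works («`X^p − r` has a non-normal root field»). [folklore] -/
theorem exists_fixed_rootOfUnity_of_fixed_root (hp : p.Prime) (H : Subgroup (absoluteGaloisGroup K))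
    [H.Normal] {r : K} (hr : ∀ s : K, s ^ p ≠ r) {s : AlgebraicClosure K}
    (hs : s ^ p = algebraMap K (AlgebraicClosure K) r) (hfix : ∀ τ ∈ H, τ • s = s) :
    ∃ ζ : AlgebraicClosure K, ζ ^ p = 1 ∧ ζ ≠ 1 ∧ ∀ τ ∈ H, τ • ζ = ζ := by
  haveI : IsGalois K (AlgebraicClosure K) := {}
  have hr0 : r ≠ 0 := fun h => hr 0 (by rw [h, zero_pow hp.ne_zero])
  have hrb0 : algebraMap K (AlgebraicClosure K) r ≠ 0 := (_root_.map_ne_zero _).mpr hr0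
  have hs0 : s ≠ 0 := by
    rintro rfl
    rw [zero_pow hp.ne_zero] at hs
    exact hrb0 hs.symm
  -- `s ∉ K`, so some `σ ∈ G_K` moves it
  obtain ⟨σ, hσ⟩ : ∃ σ : absoluteGaloisGroup K, σ • s ≠ s := by
    by_contra! h
    have hmem : s ∈ (⊥ : IntermediateField K (AlgebraicClosure K)) := by
      rw [InfiniteGalois.mem_bot_iff_fixed]
      intro f
      have := h ((absoluteGaloisGroup.toAlgEquiv K).symm f)
      rwa [absoluteGaloisGroup.toAlgEquiv_symm_apply] at this
    obtain ⟨t, ht⟩ := IntermediateField.mem_bot.mp hmem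
    refine hr t ((algebraMap K (AlgebraicClosure K)).injective ?_)
    rw [map_pow, ht, hs]
  refine ⟨σ • s * s⁻¹, ?_, ?_, ?_⟩
  · rw [mul_pow, inv_pow, ← smul_pow', hs, smul_algebraMap, mul_inv_cancel₀ hrb0]
  · intro h1
    exact hσ ((mul_inv_eq_one₀ hs0).mp h1)
  · intro τ hτ
    rw [smul_mul', smul_inv'', hfix τ hτ, smul_fixed_of_normal H hfix σ τ hτ]

/-- **No `H`-fixed `p`-th root of `r`** (`K`, `p`, `H ⊴ G_K`, `r ∈ K ∖ K^p` as above): if no `H`-fixed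
element of `K̄` is a primitive `p`-th root of unity then no `H`-fixed `s` has `s ^ p = r`. [folklore] -/
theorem pow_prime_ne_algebraMap_of_fixed (hp : p.Prime) (H : Subgroup (absoluteGaloisGroup K)) [H.Normal]
    (hμ : ∀ ζ : AlgebraicClosure K, (∀ τ ∈ H, τ • ζ = ζ) → ζ ^ p = 1 → ζ = 1)
    {r : K} (hr : ∀ s : K, s ^ p ≠ r) (s : AlgebraicClosure K) (hfix : ∀ τ ∈ H, τ • s = s) :
    s ^ p ≠ algebraMap K (AlgebraicClosure K) r := fun hs =>
  let ⟨ζ, h1, h2, h3⟩ := exists_fixed_rootOfUnity_of_fixed_root hp H hr hs hfix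
  h2 (hμ ζ h3 h1)

/-- **`μ_p(K̄^H) = 1` from degrees (memo §31.2 (α)).** If `μ_p(K) = 1` and every `H`-fixed element of `K̄`
has degree a POWER OF `p` over `K` (e.g. `K̄^H/K` Galois pro-`p`), no `H`-fixed element is a primitive
`p`-th root of unity: such a `ζ` is a root of the `p`-th cyclotomic polynomial (degree `p − 1 < p`), so
`p^j ≤ p − 1` forces `j = 0`, `ζ ∈ K`. [folklore] -/
theorem fixed_pow_prime_eq_one_of_degree (hp : p.Prime) (H : Subgroup (absoluteGaloisGroup K))
    (hK : ∀ z : K, z ^ p = 1 → z = 1)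
    (hdeg : ∀ x : AlgebraicClosure K, (∀ τ ∈ H, τ • x = x) → ∃ j : ℕ, (minpoly K x).natDegree = p ^ j)
    (ζ : AlgebraicClosure K) (hfix : ∀ τ ∈ H, τ • ζ = ζ) (hζ : ζ ^ p = 1) : ζ = 1 := by
  haveI : Fact p.Prime := ⟨hp⟩
  haveI : NeZero p := ⟨hp.ne_zero⟩
  by_contra hne
  have hprim : IsPrimitiveRoot ζ p := by
    have h := orderOf_eq_prime hζ hne
    exact h ▸ IsPrimitiveRoot.orderOf ζ
  -- `ζ` is a root of the `p`-th cyclotomic polynomial over `K`, of degree `p - 1`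
  have hroot : Polynomial.aeval ζ (Polynomial.cyclotomic p K) = 0 := by
    rw [Polynomial.aeval_def, ← Polynomial.eval_map, Polynomial.map_cyclotomic, ← Polynomial.IsRoot.def,
      Polynomial.isRoot_cyclotomic_iff]
    exact hprim
  have hle : (minpoly K ζ).natDegree ≤ p - 1 := by
    have h := Polynomial.natDegree_le_of_dvd (minpoly.dvd K ζ hroot) (Polynomial.cyclotomic_ne_zero p K)
    rwa [Polynomial.natDegree_cyclotomic, Nat.totient_prime hp] at h
  obtain ⟨j, hj⟩ := hdeg ζ hfix
  have hj0 : j = 0 := by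
    by_contra hj0
    have h1 : p ≤ p ^ j := Nat.le_self_pow hj0 p
    have h2 := hp.two_le
    omega
  rw [hj0, pow_zero] at hj
  obtain ⟨z, hz⟩ := minpoly.natDegree_eq_one_iff.mp hj
  have hz1 : z ^ p = 1 := by
    apply (algebraMap K (AlgebraicClosure K)).injective
    rw [map_pow, hz, hζ, map_one]
  exact hne (by rw [← hz, hK z hz1, map_one])

end Kummer

/-! ### §3 The Tate curve: `H`-fixed `p`-power torsion of `E_q(K̄)` is `K`-rational (no growth in `K̄^H`) -/

section Tate

open Field WeierstrassCurve Literature.NumberTheory.EllipticCurves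
  Literature.NumberTheory.EllipticCurves.TateCurve Literature.NumberTheory.EllipticCurves.SteinWuthrich2013

variable {K : Type u} [NontriviallyNormedField K] [CompleteSpace K] [IsUltrametricDist K] [CharZero K]
  {p : ℕ}

omit [CompleteSpace K] [IsUltrametricDist K] in
/-- **Core of (L1) for a given uniformisation (memo §31.2 (γ)).** `K` a normed field of characteristic
`0`, `r ∈ K`, `0 < ‖r‖ < 1`, `r ∉ K^p`, `q = r ^ p ^ k`; `φ : K̄^× ↠ M` surjective, `G_K`-equivariant, kernel
`q^ℤ` (the clauses of Tate's uniformisation, Silverman ATAEC V.3.1 (c)(d)); `H ⊴ G_K`, `μ_p(K̄^H) = 1`. Then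
every `P ∈ M` killed by `p ^ n` and fixed by `H` is `φ(r^j)`, `j ∈ ℤ`: `P = φ(w)`, `w^{p^n} ∈ q^ℤ`; for
`τ ∈ H`, `τw/w ∈ q^ℤ` is a root of unity, hence `1`; §1 in the `H`-fixed units (no `p`-torsion by `hμ`,
`r` no `p`-th power by §2) gives `w ∈ r^ℤ`. [cite: SilvermanATAEC1994, Thm. V.3.1 (c),(d) (PDF pp. 395–399)] -/
theorem exists_eq_map_zpow_of_fixed_of_torsion (hp : p.Prime) {r : K} (hr0 : r ≠ 0) (hr1 : ‖r‖ < 1)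
    (hr : ∀ s : K, s ^ p ≠ r) (k : ℕ) (H : Subgroup (absoluteGaloisGroup K)) [H.Normal]
    (hμ : ∀ ζ : AlgebraicClosure K, (∀ τ ∈ H, τ • ζ = ζ) → ζ ^ p = 1 → ζ = 1)
    {M : Type v} [AddCommGroup M] [MulAction (absoluteGaloisGroup K) M]
    (φ : Additive (AlgebraicClosure K)ˣ →+ M) (hsurj : Function.Surjective φ)
    (hker : ∀ u : (AlgebraicClosure K)ˣ, φ (Additive.ofMul u) = 0 ↔
      ∃ n : ℤ, (u : AlgebraicClosure K) = algebraMap K (AlgebraicClosure K) (r ^ p ^ k) ^ n)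
    (hequiv : ∀ (σ : absoluteGaloisGroup K) (u : (AlgebraicClosure K)ˣ),
      σ • φ (Additive.ofMul u) =
        φ (Additive.ofMul (Units.map
          (absoluteGaloisGroup.toAlgEquiv K σ : AlgebraicClosure K →* AlgebraicClosure K) u)))
    (P : M) {n : ℕ} (hP : (p ^ n) • P = 0) (hfix : ∀ τ ∈ H, τ • P = P) :
    ∃ j : ℤ, φ (Additive.ofMul ((Units.mk0 (algebraMap K (AlgebraicClosure K) r)
      ((_root_.map_ne_zero _).mpr hr0)) ^ j)) = P := by
  have hq0 : r ^ p ^ k ≠ 0 := pow_ne_zero _ hr0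
  have hq1 : ‖r ^ p ^ k‖ < 1 := by
    rw [norm_pow]; exact pow_lt_one₀ (norm_nonneg _) hr1 (pow_ne_zero _ hp.ne_zero)
  have hqb0 : algebraMap K (AlgebraicClosure K) (r ^ p ^ k) ≠ 0 := (_root_.map_ne_zero _).mpr hq0
  have hrb0 : algebraMap K (AlgebraicClosure K) r ≠ 0 := (_root_.map_ne_zero _).mpr hr0
  -- (1) a preimage `w` of `P`; `w^{p^n} ∈ q^ℤ`
  obtain ⟨a, ha⟩ := hsurj P
  have hφw : φ (Additive.ofMul (Additive.toMul a)) = P := by simpa using ha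
  generalize Additive.toMul a = w at hφw
  have htor : ∃ m : ℤ, ((w ^ p ^ n : (AlgebraicClosure K)ˣ) : AlgebraicClosure K) =
      algebraMap K (AlgebraicClosure K) (r ^ p ^ k) ^ m := by
    rw [← hker, ofMul_pow, map_nsmul, hφw, hP]
  obtain ⟨m, hm⟩ := htor
  rw [Units.val_pow_eq_pow_val] at hm
  -- (2) `w` is `H`-fixed
  have hwfix : ∀ τ ∈ H, τ • (w : AlgebraicClosure K) = w := by
    intro τ hτ
    have h1 : φ (Additive.ofMul (Units.map
        (absoluteGaloisGroup.toAlgEquiv K τ : AlgebraicClosure K →* AlgebraicClosure K) w)) =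
        φ (Additive.ofMul w) := by
      rw [← hequiv, hφw, hfix τ hτ]
    have h2 : φ (Additive.ofMul (Units.map
        (absoluteGaloisGroup.toAlgEquiv K τ : AlgebraicClosure K →* AlgebraicClosure K) w * w⁻¹)) = 0 := by
      rw [ofMul_mul, ofMul_inv, map_add, map_neg, h1, add_neg_cancel]
    obtain ⟨j, hj⟩ := (hker _).mp h2
    rw [Units.val_mul, Units.coe_map, MonoidHom.coe_coe, Units.val_inv_eq_inv_val] at hj
    -- `(τ w / w)^{p^n} = 1`, so `q^{j p^n} = 1` and `j = 0`
    have h3 : (absoluteGaloisGroup.toAlgEquiv K τ (w : AlgebraicClosure K) * (↑w)⁻¹) ^ p ^ n = 1 := by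
      rw [mul_pow, inv_pow, ← map_pow, hm, map_zpow₀, AlgEquiv.commutes,
        mul_inv_cancel₀ (zpow_ne_zero _ hqb0)]
    rw [hj, ← zpow_natCast, ← zpow_mul] at h3
    have h4 : j * ((p ^ n : ℕ) : ℤ) = 0 :=
      zpow_algebraMap_injective hq0 hq1 (h3.trans (zpow_zero _).symm)
    have hj0 : j = 0 := by
      rcases mul_eq_zero.mp h4 with h | h
      · exact h
      · exact absurd h (by exact_mod_cast pow_ne_zero n hp.ne_zero)
    rw [hj0, zpow_zero, mul_inv_eq_one₀ (Units.ne_zero w)] at hj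
    rw [absoluteGaloisGroup.smul_def]
    exact hj
  -- (3) the subgroup of `H`-fixed units of `K̄`
  let F : Subgroup (AlgebraicClosure K)ˣ :=
    { carrier := {x | ∀ τ ∈ H, τ • (x : AlgebraicClosure K) = x}
      mul_mem' := fun {x y} hx hy τ hτ => by
        rw [Units.val_mul, smul_mul', hx τ hτ, hy τ hτ]
      one_mem' := fun τ _ => by rw [Units.val_one, smul_one]
      inv_mem' := fun {x} hx τ hτ => by rw [Units.val_inv_eq_inv_val, smul_inv'', hx τ hτ] }
  have hwF : w ∈ F := hwfix
  set ru : (AlgebraicClosure K)ˣ := Units.mk0 (algebraMap K (AlgebraicClosure K) r) hrb0 with hru_def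
  have hru : (ru : AlgebraicClosure K) = algebraMap K (AlgebraicClosure K) r := by
    rw [hru_def, Units.val_mk0]
  have hruF : ru ∈ F := fun τ _ => by rw [hru, smul_algebraMap]
  have hFp : ∀ g ∈ F, g ^ p = 1 → g = 1 := fun g hg hgp =>
    Units.ext (hμ g hg (by rw [← Units.val_pow_eq_pow_val, hgp, Units.val_one]))
  have hFr : ∀ s ∈ F, s ^ p ≠ ru := fun s hs hsp =>
    pow_prime_ne_algebraMap_of_fixed hp H hμ hr s hs
      (by rw [← Units.val_pow_eq_pow_val, hsp, hru])
  -- `w^{p^n} = ru^{p^k m}` in `K̄^×`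
  have hwpow : w ^ p ^ n = ru ^ (((p ^ k : ℕ) : ℤ) * m) := by
    ext
    rw [Units.val_pow_eq_pow_val, hm, zpow_mul, zpow_natCast, Units.val_zpow_eq_zpow_val,
      Units.val_pow_eq_pow_val, hru, ← map_pow]
  obtain ⟨j, hj⟩ := Subgroup.mem_zpowers_iff.mp
    (mem_zpowers_of_pow_prime_pow_eq_zpow hp F hFp hruF hFr n w hwF _ hwpow)
  exact ⟨j, by rw [hj, hφw]⟩

/-- **(L1), torsion rigidity (memo §31.2 Lemma L1, PROVED in the kernel).** `K` complete ultrametric of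
characteristic `0`, `p` prime, `q = r ^ p ^ k ∈ K` with `0 < ‖r‖ < 1`, `r ∉ K^p` (for `K = ℚ_p`:
`k = max {j : q ∈ (ℚ_p^×)^{p^j}}`), `H ⊴ G_K` normal with no `H`-fixed primitive `p`-th root of unity
(e.g. `K̄^H/K` pro-`p` and `μ_p ⊄ K`, `fixed_pow_prime_eq_one_of_degree`). Then EVERY `H`-fixed
`p`-power-torsion point of the Tate curve `E_q(K̄)` is `G_K`-fixed: **`E_q(K̄^H)[p^∞] = E_q(K)[p^∞]`**.
From the tree's theorem `uniformization_holds` (ATAEC V.3.1 (c)(d)) and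
`exists_eq_map_zpow_of_fixed_of_torsion`. For T♭: `K = ℚ_p`, `K̄^H = K_{∞,w}` the anticyclotomic local
tower (a `ℤ_p`-extension, `p` odd) — the control defect `H⁰(K_{∞,w}, E[p^∞]) = E(ℚ_p)[p^∞]` does not
depend on the layer. [cite: SilvermanATAEC1994, Thm. V.3.1 (c),(d) (PDF pp. 395–399)] -/
theorem smul_eq_self_of_fixed_of_torsion (hp : p.Prime) {r : K} (hr0 : r ≠ 0) (hr1 : ‖r‖ < 1)
    (hr : ∀ s : K, s ^ p ≠ r) (k : ℕ) (H : Subgroup (absoluteGaloisGroup K)) [H.Normal]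
    (hμ : ∀ ζ : AlgebraicClosure K, (∀ τ ∈ H, τ • ζ = ζ) → ζ ^ p = 1 → ζ = 1)
    (P : geomPoints (tateCurve (r ^ p ^ k))) {n : ℕ} (hP : (p ^ n) • P = 0)
    (hfix : ∀ τ ∈ H, τ • P = P) (σ : absoluteGaloisGroup K) : σ • P = P := by
  have hq0 : r ^ p ^ k ≠ 0 := pow_ne_zero _ hr0
  have hq1 : ‖r ^ p ^ k‖ < 1 := by
    rw [norm_pow]; exact pow_lt_one₀ (norm_nonneg _) hr1 (pow_ne_zero _ hp.ne_zero)
  obtain ⟨φ, hsurj, hker, hequiv, -⟩ := uniformization_holds (r ^ p ^ k) hq0 hq1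
  obtain ⟨j, hj⟩ := exists_eq_map_zpow_of_fixed_of_torsion hp hr0 hr1 hr k H hμ φ hsurj hker hequiv
    P hP hfix
  rw [← hj, hequiv]
  congr 2
  ext
  rw [Units.coe_map, MonoidHom.coe_coe, Units.val_zpow_eq_zpow_val, map_zpow₀, Units.val_mk0,
    AlgEquiv.commutes]

/-- **(L1), structure form: `E_q(K̄^H)[p^∞]` is cyclic of order `p^k` on ONE `K`-rational generator, for
every admissible `H` at once.** Under the hypotheses of `smul_eq_self_of_fixed_of_torsion` there is
`P₀ ∈ E_q(K̄)` (the image of `r`), `G_K`-fixed, of exact order `p ^ k`, such that every `H`-fixed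
`p`-power-torsion point is an integer multiple of `P₀` — the bound `p^{c₀}` of memo §31.2, uniform in the
layer. [cite: SilvermanATAEC1994, Thm. V.3.1 (c),(d) (PDF pp. 395–399)] -/
theorem exists_generator_fixed_torsion (hp : p.Prime) {r : K} (hr0 : r ≠ 0) (hr1 : ‖r‖ < 1)
    (hr : ∀ s : K, s ^ p ≠ r) (k : ℕ) (H : Subgroup (absoluteGaloisGroup K)) [H.Normal]
    (hμ : ∀ ζ : AlgebraicClosure K, (∀ τ ∈ H, τ • ζ = ζ) → ζ ^ p = 1 → ζ = 1) :
    ∃ P₀ : geomPoints (tateCurve (r ^ p ^ k)),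
      (∀ σ : absoluteGaloisGroup K, σ • P₀ = P₀) ∧ (p ^ k) • P₀ = 0 ∧
      (∀ j : ℕ, j • P₀ = 0 → p ^ k ∣ j) ∧
      ∀ (P : geomPoints (tateCurve (r ^ p ^ k))) (n : ℕ), (p ^ n) • P = 0 →
        (∀ τ ∈ H, τ • P = P) → ∃ j : ℤ, P = j • P₀ := by
  have hq0 : r ^ p ^ k ≠ 0 := pow_ne_zero _ hr0
  have hq1 : ‖r ^ p ^ k‖ < 1 := by
    rw [norm_pow]; exact pow_lt_one₀ (norm_nonneg _) hr1 (pow_ne_zero _ hp.ne_zero)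
  have hrb0 : algebraMap K (AlgebraicClosure K) r ≠ 0 := (_root_.map_ne_zero _).mpr hr0
  obtain ⟨φ, hsurj, hker, hequiv, -⟩ := uniformization_holds (r ^ p ^ k) hq0 hq1
  set ru : (AlgebraicClosure K)ˣ := Units.mk0 (algebraMap K (AlgebraicClosure K) r) hrb0 with hru_def
  refine ⟨φ (Additive.ofMul ru), ?_, ?_, ?_, ?_⟩
  · intro σ
    rw [hequiv]
    congr 2
    ext
    rw [Units.coe_map, MonoidHom.coe_coe, hru_def, Units.val_mk0, AlgEquiv.commutes]
  · rw [← map_nsmul, ← ofMul_pow, hker]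
    exact ⟨1, by rw [zpow_one, Units.val_pow_eq_pow_val, hru_def, Units.val_mk0, map_pow]⟩
  · intro j hj
    rw [← map_nsmul, ← ofMul_pow, hker] at hj
    obtain ⟨m, hm⟩ := hj
    rw [Units.val_pow_eq_pow_val, hru_def, Units.val_mk0, map_pow, ← zpow_natCast, ← zpow_natCast,
      ← zpow_mul] at hm
    have h := zpow_algebraMap_injective hr0 hr1 hm
    exact Int.natCast_dvd_natCast.mp ⟨m, h⟩
  · intro P n hP hfix
    obtain ⟨j, hj⟩ := exists_eq_map_zpow_of_fixed_of_torsion hp hr0 hr1 hr k H hμ φ hsurj hker hequiv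
      P hP hfix
    exact ⟨j, by rw [← hj, ofMul_zpow, map_zsmul]⟩

end Tate

end Summit.BirchSwinnertonDyer.BirchSwinnertonDyer.Theorems.TateTorsionRigidity

end
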